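import Summits.ResolutionOfSingularities.ResolutionOfSingularities.Theorems.WeightedInvariantTieFinitePrimesOverChart
import Summits.ResolutionOfSingularities.ResolutionOfSingularities.Theorems.WeightedInvariantTieFiniteChartPrelims
import Summits.ResolutionOfSingularities.ResolutionOfSingularities.Theorems.WeightedInvariantTieFinitePointwise
import Summits.ResolutionOfSingularities.ResolutionOfSingularities.Theorems.WeightedInvariantIota3EpsTopStratum
import Summits.ResolutionOfSingularities.ResolutionOfSingularities.Theorems.WeightedInvariantStratumIffOfStrat
import Literature.AlgebraicGeometry.Resolution.CotangentIndependenceSpread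
import HarnessLib

/-!
# (Δ10-d) FINITELY MANY TIE PRIMES OVER A HEIGHT-TWO EQUIMULTIPLE CURVE — PART 2, THE KEY: `TieFinite.finite_tiePrimes_over`
# (door `HypersurfaceCentreConstruction`, stmt-ResolutionOfSingularities-19897; P3 rung inputs h7 (c8τ) / h8 (T); SPEC (Δ10) rev 3
# `L/res-L1-w43-plan-1/TieFreeNearCurve_sketch.lean` da180fe30ecb838c §(Δ10-d) VERBATIM; DEAL (o52-T-b), hand res-D-brk-1)

Topic: `Summits/ResolutionOfSingularities/ResolutionOfSingularities/Theorems`. Helper for the door item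
`HypersurfaceCentreConstruction` (stmt-ResolutionOfSingularities-19897, route `WeightedInvariant`), line `local-engine`
(L W4.3), def-free.  THE KEY (registrar's words): «`k₀` perfect, `A` of finite type, `𝔭` prime with `A_𝔭` regular of dimension `2`,
`0 ≠ F/1 ∈ 𝔪_{A_𝔭}²`.  The set of primes `𝔮 > 𝔭` with `dim A_𝔮 ≤ 3` at which `F` is a tie position whose `(ν ; ε)`-top-stratum
prime is `𝔭 A_𝔮` is FINITE.  No `𝔪`, no closedness, no equivariance.»  With the (Δ10-e) glue (res-D-brk-1
`JOpenLE3.tieFreeAlongCurveLE3_of_finite`, p557074) this closes INPUT (T) `JOpenLE3.TieFreeAlongCurveLE3 p` of the (open″)≤3 assembly.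

ROUTE.  (K1) If the set is empty we are done; otherwise a member `𝔮₀` carries a tie presentation (res-type-092's
`Iota3.IsTiePresentation`), whose lex-maximal transversal datum `(y, x; r, q; rν)` at `(A_𝔮₀)_{𝔭 A_𝔮₀} ≃ A_𝔭` descends to numerators
`U = (a_y, a_x)` in `A` (res-type-047's `isLexMaxWeightedCentreGerm_unit_mul`, `isLexMax_of_localization_localization`), with
`ν = ord_{A_𝔭} F ≥ 2`.  (K2)(K3) PART 1 `exists_tieChart` (p-`…TieFinitePrimesOverChart`): a chart `s ∉ 𝔭` with the pair clause on
`V(U) ∩ D(s)` and the covering tie primes of `A_s` finite (res-type-047 `finite_tiePrimes` / (Δ10-c) `finite_tiePrimes'`).  (K5) A member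
`𝔮 ∌ s` extends to a covering tie prime of `A_s` (`A_𝔮 ≃ (A_s)_{𝔮 A_s}` carries regularity, the independent pair, the tie position, the
order `ν` and the top-stratum prime; covering from heights `2` / `≤ 3`, (Δ10-b) `eq_of_height_of_lt_of_le`), injectively.  (K4) The
members `∋ s` are handled by (Δ10-b) `finite_of_finite_sep_not_mem`.

[OURS · L1 W4.3 · (Δ10-d)]  Replaces the role of NO printed item; NOT a statement of the manuscript
[claim: Hironaka2017, status: under-review]. AI work, weaker than expert review.  Pure commutative algebra; no named facts.

## References

* D. Abramovich, M. H. Quek, B. Schober, arXiv:2507.01232 (2025), Thm 1.3 (3), Thm 3.5. [AbramovichQuekSchober2025]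
* H. Matsumura, *Commutative Ring Theory* (1987), §5 / Thm. 13.5 (heights), Thm. 4.3. [Matsumura1987]
* res-L1-w43-plan-1, SPEC (Δ10) rev 3 and REGISTRAR RULING #13; res-type-047, D2-INCHART-SPEC v3 (OURS, AI planning).
-/

noncomputable section

set_option linter.dupNamespace false -- mandated namespace `Summit.<Summit>.<Problem>` of this single-conjunct summit

open IsLocalRing Literature.AlgebraicGeometry.Resolution
open Summit.ResolutionOfSingularities.ResolutionOfSingularities.Theorems
open Summit.ResolutionOfSingularities.ResolutionOfSingularities.Theorems.ContactCylinder

namespace Summit.ResolutionOfSingularities.ResolutionOfSingularities.Cruxes.HypersurfaceCentreConstruction.LocalEngine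

namespace TieFinite

open Iota3

/-! ## (K1) The datum at `A_𝔭` from a member's tie presentation -/

/-- **(K1) THE LEX-MAXIMAL DATUM AT `A_𝔭` FROM ONE TIE PRIME OVER `𝔭`.**  If `𝔮₀ > 𝔭` is a tie position of `F` whose
`(ν ; ε)`-top-stratum prime is `𝔭 A_𝔮₀`, then for some `x, g ∈ A` and `r, q, n` with `n = ord_{A_𝔭} F ≥ 2`, `(x/1, g/1; r, q; r n)` is
a lex-maximal admissible weighted centre germ of `(F/1) ⊆ A_𝔭` (the tie presentation's transversal datum, descended along
`(A_𝔮₀)_{𝔭 A_𝔮₀} ≃ A_𝔭` with numerators). [OURS · L1 W4.3 · (Δ10-d) (K1)] -/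
theorem exists_lexMax_datum_of_tiePrime {A : Type} [CommRing A] (F : A) (𝔭 : Ideal A) [𝔭.IsPrime]
    (𝔮₀ : Ideal A) [𝔮₀.IsPrime] (hlt : 𝔭 < 𝔮₀)
    (htie : IsTiePosition (Localization.AtPrime 𝔮₀) (algebraMap A (Localization.AtPrime 𝔮₀) F))
    (htop : topStratumPrime iotaOrdEps (Localization.AtPrime 𝔮₀) (algebraMap A (Localization.AtPrime 𝔮₀) F) =
      𝔭.map (algebraMap A (Localization.AtPrime 𝔮₀))) :
    ∃ (x g : A) (r q n : ℕ), 2 ≤ n ∧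
      iotaOrd (Localization.AtPrime 𝔭) (algebraMap A (Localization.AtPrime 𝔭) F) = (n : ℕ) ∧
      adicOrder (algebraMap A (Localization.AtPrime 𝔭) F) = (n : ℕ∞) ∧
      IsLexMaxWeightedCentreGerm (Localization.AtPrime 𝔭) (Ideal.span {algebraMap A (Localization.AtPrime 𝔭) F})
        (fun i => algebraMap A (Localization.AtPrime 𝔭) ((![x, g] : Fin 2 → A) i)) ![r, q] (r * n) := by
  classical
  haveI := htie.isRegularLocalRing
  haveI := isDomain_of_isRegularLocalRing (Localization.AtPrime 𝔮₀)
  haveI := isPrime_map_atPrime_of_le 𝔭 𝔮₀ hlt.le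
  have htie' := htie
  obtain ⟨_, hdim₀, -, -, x₁, y₁, z₁, q, r, lam, hpres⟩ := htie
  obtain ⟨-, hP₀, ν, hPpr, hfν, hfν1, hlex₀, -⟩ := hpres
  haveI := hPpr
  have hn : 2 ≤ ν := IsTiePosition.two_le_order htie' hfν hfν1
  -- the top-stratum prime is `(x₁, y₁) = 𝔭 A_𝔮₀`
  have hspanP : Ideal.span {x₁, y₁} = 𝔭.map (algebraMap A (Localization.AtPrime 𝔮₀)) := hP₀.symm.trans htop
  have hP₀comap : (Ideal.span {x₁, y₁}).comap (algebraMap A (Localization.AtPrime 𝔮₀)) = 𝔭 := by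
    rw [hspanP]; exact comap_map_atPrime_of_le 𝔭 𝔮₀ hlt.le
  -- the order at `A_𝔮₀` and at `A_𝔭` is `ν`
  have hν₀ : iotaOrd (Localization.AtPrime 𝔮₀) (algebraMap A (Localization.AtPrime 𝔮₀) F) = (ν : ℕ) :=
    (iotaOrd_eq_natCast_iff _ _ _).mpr ⟨hfν, hfν1⟩
  have hf0 : algebraMap A (Localization.AtPrime 𝔮₀) F ≠ 0 := fun h => hfν1 (by rw [h]; exact Ideal.zero_mem _)
  have hfm : algebraMap A (Localization.AtPrime 𝔮₀) F ∈ maximalIdeal (Localization.AtPrime 𝔮₀) :=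
    Ideal.pow_le_self (by omega) hfν
  obtain ⟨_, -, hfP₀, -, hkept, -⟩ := topStratumPrime_iotaOrdEps_spec (le_of_eq hdim₀) hf0 hfm hν₀
  rw [htop] at hfP₀ hkept
  have hνP : iotaOrd (Localization.AtPrime (𝔭.map (algebraMap A (Localization.AtPrime 𝔮₀))))
      (algebraMap (Localization.AtPrime 𝔮₀) _ (algebraMap A (Localization.AtPrime 𝔮₀) F)) = (ν : ℕ) := by
    have h := (hkept (𝔭.map (algebraMap A (Localization.AtPrime 𝔮₀))) hfP₀).mpr le_rfl
    rw [iotaOrdEps_eq_iff] at h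
    rw [h.1, hν₀]
  have hν𝔭 : iotaOrd (Localization.AtPrime 𝔭) (algebraMap A (Localization.AtPrime 𝔭) F) = (ν : ℕ) := by
    rw [← hνP, StratumIff.iota_localization_localization_eq iotaOrd iotaOrd_isoInvariant 𝔮₀ _ F,
      StratumIff.iota_localization_congr iotaOrd (comap_map_atPrime_of_le 𝔭 𝔮₀ hlt.le) F]
  have hord𝔭 : adicOrder (algebraMap A (Localization.AtPrime 𝔭) F) = (ν : ℕ∞) := by
    obtain ⟨h1, h2⟩ := (iotaOrd_eq_natCast_iff _ _ _).mp hν𝔭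
    exact le_antisymm ((adicOrder_le_iff _ ν).mpr h2) ((le_adicOrder_iff _ ν).mpr h1)
  -- numerators of the transversal datum `(y₁, x₁)`
  obtain ⟨⟨ay, sy⟩, hy⟩ := IsLocalization.surj 𝔮₀.primeCompl y₁
  obtain ⟨⟨ax, sx⟩, hx⟩ := IsLocalization.surj 𝔮₀.primeCompl x₁
  simp only at hy hx
  have hsyu : IsUnit (algebraMap A (Localization.AtPrime 𝔮₀) (sy : A)) := IsLocalization.map_units _ sy
  have hsxu : IsUnit (algebraMap A (Localization.AtPrime 𝔮₀) (sx : A)) := IsLocalization.map_units _ sx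
  -- the lex-maximal datum for the unit multiples `(a_y/1, a_x/1) = (s_y y₁, s_x x₁)` at `(A_𝔮₀)_{P₀}`
  let c : Fin 2 → Localization.AtPrime (Ideal.span {x₁, y₁}) :=
    ![algebraMap (Localization.AtPrime 𝔮₀) _ (algebraMap A (Localization.AtPrime 𝔮₀) (sy : A)),
      algebraMap (Localization.AtPrime 𝔮₀) _ (algebraMap A (Localization.AtPrime 𝔮₀) (sx : A))]
  have hc : ∀ i, IsUnit (c i) := by
    intro i; fin_cases i
    · exact hsyu.map _
    · exact hsxu.map _
  have hlexc := isLexMaxWeightedCentreGerm_unit_mul hlex₀ c hc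
  have hfun : (fun i => c i * (![algebraMap (Localization.AtPrime 𝔮₀) (Localization.AtPrime (Ideal.span {x₁, y₁})) y₁,
        algebraMap (Localization.AtPrime 𝔮₀) (Localization.AtPrime (Ideal.span {x₁, y₁})) x₁] : Fin 2 → _) i) =
      fun i => algebraMap (Localization.AtPrime 𝔮₀) (Localization.AtPrime (Ideal.span {x₁, y₁}))
        (algebraMap A (Localization.AtPrime 𝔮₀) ((![ay, ax] : Fin 2 → A) i)) := by
    funext i; fin_cases i
    · show algebraMap (Localization.AtPrime 𝔮₀) (Localization.AtPrime (Ideal.span {x₁, y₁})) (algebraMap A _ (sy : A)) *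
          algebraMap (Localization.AtPrime 𝔮₀) (Localization.AtPrime (Ideal.span {x₁, y₁})) y₁ =
        algebraMap (Localization.AtPrime 𝔮₀) (Localization.AtPrime (Ideal.span {x₁, y₁})) (algebraMap A _ ay)
      rw [← map_mul, mul_comm, hy]
    · show algebraMap (Localization.AtPrime 𝔮₀) (Localization.AtPrime (Ideal.span {x₁, y₁})) (algebraMap A _ (sx : A)) *
          algebraMap (Localization.AtPrime 𝔮₀) (Localization.AtPrime (Ideal.span {x₁, y₁})) x₁ =
        algebraMap (Localization.AtPrime 𝔮₀) (Localization.AtPrime (Ideal.span {x₁, y₁})) (algebraMap A _ ax)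
      rw [← map_mul, mul_comm, hx]
  rw [hfun] at hlexc
  refine ⟨ay, ax, r, q, ν, hn, hν𝔭, hord𝔭, ?_⟩
  exact isLexMax_of_localization_localization 𝔮₀ (Ideal.span {x₁, y₁}) 𝔭 hP₀comap hlexc

/-! ## The order along the stratum -/

/-- If the `(ν ; ε)`-top-stratum prime of `(A_𝔮, F)` is `𝔭 A_𝔮` (`𝔭 ≤ 𝔮`, `A_𝔮` regular of dimension `≤ 3`, `0 ≠ F/1 ∈ 𝔪_𝔮`),
then `ord_{A_𝔮} F = ord_{A_𝔭} F` (the pair `(ν ; ε)` is kept at the generic prime of its top stratum; `(A_𝔮)_{𝔭 A_𝔮} ≃ A_𝔭`). [OURS] -/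
theorem iotaOrd_eq_of_topStratumPrime_eq_map {A : Type} [CommRing A] (F : A) (𝔭 𝔮 : Ideal A) [𝔭.IsPrime] [𝔮.IsPrime]
    [IsRegularLocalRing (Localization.AtPrime 𝔮)] (hle : 𝔭 ≤ 𝔮) (hdim : ringKrullDim (Localization.AtPrime 𝔮) ≤ 3)
    (hf0 : algebraMap A (Localization.AtPrime 𝔮) F ≠ 0)
    (hfm : algebraMap A (Localization.AtPrime 𝔮) F ∈ maximalIdeal (Localization.AtPrime 𝔮))
    (htop : topStratumPrime iotaOrdEps (Localization.AtPrime 𝔮) (algebraMap A (Localization.AtPrime 𝔮) F) =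
      𝔭.map (algebraMap A (Localization.AtPrime 𝔮))) :
    iotaOrd (Localization.AtPrime 𝔮) (algebraMap A (Localization.AtPrime 𝔮) F) =
      iotaOrd (Localization.AtPrime 𝔭) (algebraMap A (Localization.AtPrime 𝔭) F) := by
  haveI := isPrime_map_atPrime_of_le 𝔭 𝔮 hle
  obtain ⟨-, hfν, hfν1⟩ := EssSmoothLevels.adicOrder_toNat_spec hf0 hfm
  have hν : iotaOrd (Localization.AtPrime 𝔮) (algebraMap A (Localization.AtPrime 𝔮) F) =
      ((adicOrder (algebraMap A (Localization.AtPrime 𝔮) F)).toNat : ℕ) := (iotaOrd_eq_natCast_iff _ _ _).mpr ⟨hfν, hfν1⟩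
  obtain ⟨_, -, hfP₀, -, hkept, -⟩ := topStratumPrime_iotaOrdEps_spec hdim hf0 hfm hν
  rw [htop] at hfP₀ hkept
  have h := (hkept (𝔭.map (algebraMap A (Localization.AtPrime 𝔮))) hfP₀).mpr le_rfl
  rw [iotaOrdEps_eq_iff] at h
  rw [← h.1, StratumIff.iota_localization_localization_eq iotaOrd iotaOrd_isoInvariant 𝔮 _ F,
    StratumIff.iota_localization_congr iotaOrd (comap_map_atPrime_of_le 𝔭 𝔮 hle) F]

/-! ## (Δ10-d) THE KEY -/

/-- **(Δ10-d) KEY — FINITELY MANY TIE PRIMES OVER THE CURVE, GLOBALLY.**  `k₀` perfect, `A` of finite type, `𝔭` prime with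
`A_𝔭` regular of dimension `2`, `0 ≠ F/1 ∈ 𝔪_{A_𝔭}²`.  The set of primes `𝔮 > 𝔭` with `dim A_𝔮 ≤ 3` at which `F` is a tie position
whose `(ν ; ε)`-top-stratum prime is `𝔭 A_𝔮` is FINITE (SPEC (Δ10) rev 3 §(Δ10-d) verbatim; no `𝔪`, no closedness, no
equivariance; the hypotheses `0 ≠ F/1 ∈ 𝔪²_{A_𝔭}` of the SPEC are kept in the signature but not used — the datum comes from a
member of the set, which is empty otherwise). [OURS · L1 W4.3 · (Δ10-d) = (o52-T-b)] [cite: AbramovichQuekSchober2025, Thm 1.3 (3), Thm 3.5] -/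
theorem finite_tiePrimes_over (k₀ : Type) [Field k₀] [PerfectField k₀]
    (A : Type) [CommRing A] [Algebra k₀ A] [Algebra.FiniteType k₀ A] (F : A)
    (𝔭 : Ideal A) [𝔭.IsPrime] [IsRegularLocalRing (Localization.AtPrime 𝔭)]
    (hdim𝔭 : ringKrullDim (Localization.AtPrime 𝔭) = (2 : ℕ))
    (_hF0 : algebraMap A (Localization.AtPrime 𝔭) F ≠ 0)
    (_hF2 : algebraMap A (Localization.AtPrime 𝔭) F ∈ (maximalIdeal (Localization.AtPrime 𝔭)) ^ 2) :
    {𝔮 : PrimeSpectrum A | 𝔭 < 𝔮.asIdeal ∧ ringKrullDim (Localization.AtPrime 𝔮.asIdeal) ≤ (3 : ℕ) ∧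
      Iota3.IsTiePosition (Localization.AtPrime 𝔮.asIdeal) (algebraMap A (Localization.AtPrime 𝔮.asIdeal) F) ∧
      ContactCylinder.topStratumPrime Iota3.iotaOrdEps (Localization.AtPrime 𝔮.asIdeal)
        (algebraMap A (Localization.AtPrime 𝔮.asIdeal) F) = 𝔭.map (algebraMap A (Localization.AtPrime 𝔮.asIdeal))}.Finite := by
  classical
  haveI : IsNoetherianRing A := Algebra.FiniteType.isNoetherianRing k₀ A
  set T := {𝔮 : PrimeSpectrum A | 𝔭 < 𝔮.asIdeal ∧ ringKrullDim (Localization.AtPrime 𝔮.asIdeal) ≤ (3 : ℕ) ∧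
      Iota3.IsTiePosition (Localization.AtPrime 𝔮.asIdeal) (algebraMap A (Localization.AtPrime 𝔮.asIdeal) F) ∧
      ContactCylinder.topStratumPrime Iota3.iotaOrdEps (Localization.AtPrime 𝔮.asIdeal)
        (algebraMap A (Localization.AtPrime 𝔮.asIdeal) F) = 𝔭.map (algebraMap A (Localization.AtPrime 𝔮.asIdeal))} with hT
  rcases T.eq_empty_or_nonempty with hT0 | ⟨𝔮₀, hlt₀, -, htie₀, htop₀⟩
  · rw [hT0]; exact Set.finite_empty
  -- (K1) the datum at `A_𝔭` from the member `𝔮₀`; (K2)(K3) the chart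
  obtain ⟨x, g, r, q, n, hn, hν𝔭, hord𝔭, hlex⟩ := exists_lexMax_datum_of_tiePrime F 𝔭 𝔮₀.asIdeal hlt₀ htie₀ htop₀
  have hdim𝔭' : ringKrullDim (Localization.AtPrime 𝔭) = 2 := by rw [hdim𝔭]; norm_cast
  obtain ⟨s, hs𝔭, Hpair, hfin'⟩ := exists_tieChart k₀ A F 𝔭 hdim𝔭' hn hord𝔭 x g hlex
  -- `x, g ∈ 𝔭`
  have hU𝔭 : ∀ i, (![x, g] : Fin 2 → A) i ∈ 𝔭 := fun i =>
    (IsLocalization.AtPrime.to_map_mem_maximal_iff (Localization.AtPrime 𝔭) 𝔭 _).mp (hlex.1 ▸ Ideal.subset_span ⟨i, rfl⟩)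
  -- heights: `ht 𝔭 = 2`, members have height `≤ 3`, so every member covers `𝔭`
  have hht𝔭 : 𝔭.height = 2 := height_eq_of_ringKrullDim_eq hdim𝔭
  have hht𝔭2 : (2 : ℕ∞) ≤ 𝔭.height := hht𝔭.ge
  -- (K4): it suffices to control the members not containing `s`
  refine finite_of_finite_sep_not_mem 𝔭 s hs𝔭 T (fun 𝔮 h => h.1.le) (fun 𝔮 h𝔮 q' hq' hlt hle => ?_) ?_
  · haveI := hq'
    exact eq_of_height_of_lt_of_le hht𝔭2 (height_le_of_ringKrullDim_le h𝔮.2.1) q' hq' hlt hle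
  -- (K5): the members not containing `s` come from the finite chart set by contraction
  refine (hfin'.image (PrimeSpectrum.comap (algebraMap A (Localization.Away s)))).subset ?_
  rintro 𝔮 ⟨⟨hlt, hdim𝔮, htie, htop⟩, hs𝔮⟩
  change s ∉ 𝔮.asIdeal at hs𝔮
  have htie : IsTiePosition (Localization.AtPrime 𝔮.asIdeal) (algebraMap A (Localization.AtPrime 𝔮.asIdeal) F) := htie
  haveI hQ' := isPrime_map_away s 𝔮.asIdeal hs𝔮
  haveI hP' := isPrime_map_away s 𝔭 hs𝔭
  refine ⟨⟨𝔮.asIdeal.map (algebraMap A (Localization.Away s)), hQ'⟩, ?_,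
    PrimeSpectrum.ext (comap_map_away s 𝔮.asIdeal hs𝔮)⟩
  -- the data at `A_𝔮` and the iso `e : A_𝔮 ≃ (A_s)_{𝔮 A_s}`
  haveI hreg𝔮 := htie.isRegularLocalRing
  obtain ⟨e, he⟩ := exists_ringEquiv_away_map s 𝔮.asIdeal hs𝔮
  have hf0𝔮 : algebraMap A (Localization.AtPrime 𝔮.asIdeal) F ≠ 0 := IsTiePosition.ne_zero htie
  obtain ⟨_, hfm𝔮⟩ := IsTiePosition.mem_maximalIdeal htie
  have hdim𝔮3 : ringKrullDim (Localization.AtPrime 𝔮.asIdeal) ≤ 3 := le_of_eq htie.2.1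
  have hν𝔮 : iotaOrd (Localization.AtPrime 𝔮.asIdeal) (algebraMap A (Localization.AtPrime 𝔮.asIdeal) F) = (n : ℕ) := by
    rw [iotaOrd_eq_of_topStratumPrime_eq_map F 𝔭 𝔮.asIdeal hlt.le hdim𝔮3 hf0𝔮 hfm𝔮 htop, hν𝔭]
  obtain ⟨hfn, hfn1⟩ := (iotaOrd_eq_natCast_iff _ _ _).mp hν𝔮
  obtain ⟨-, hreg𝔮', hu, hli⟩ := Hpair 𝔮.asIdeal hs𝔮 (hlt.le (hU𝔭 0)) (hlt.le (hU𝔭 1))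
  have hex : ∀ i, e (algebraMap A (Localization.AtPrime 𝔮.asIdeal) ((![x, g] : Fin 2 → A) i)) ∈
      maximalIdeal (Localization.AtPrime (𝔮.asIdeal.map (algebraMap A (Localization.Away s)))) := by
    intro i
    rw [he]
    exact (IsLocalization.AtPrime.to_map_mem_maximal_iff _ (𝔮.asIdeal.map (algebraMap A (Localization.Away s))) _).mpr
      (Ideal.mem_map_of_mem _ (hlt.le (hU𝔭 i)))
  have hli' := linearIndependent_toCotangent_map_ringEquiv e _ hu hli hex
  have hu' : ∀ i, algebraMap (Localization.Away s) (Localization.AtPrime (𝔮.asIdeal.map (algebraMap A (Localization.Away s))))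
      ((fun i => algebraMap A (Localization.Away s) ((![x, g] : Fin 2 → A) i)) i) ∈
        maximalIdeal (Localization.AtPrime (𝔮.asIdeal.map (algebraMap A (Localization.Away s)))) :=
    fun i => (he _) ▸ hex i
  -- heights on the chart
  have hdisj𝔭 := disjoint_powers_of_not_mem s 𝔭 hs𝔭
  have hdisj𝔮 := disjoint_powers_of_not_mem s 𝔮.asIdeal hs𝔮
  have hhtP' : (2 : ℕ∞) ≤ (𝔭.map (algebraMap A (Localization.Away s))).height := by
    rw [IsLocalization.height_map_of_disjoint (Submonoid.powers s) 𝔭 hdisj𝔭]; exact hht𝔭2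
  have hhtQ' : (𝔮.asIdeal.map (algebraMap A (Localization.Away s))).height ≤ 3 := by
    rw [IsLocalization.height_map_of_disjoint (Submonoid.powers s) 𝔮.asIdeal hdisj𝔮]
    exact height_le_of_ringKrullDim_le hdim𝔮
  -- the top-stratum prime on the chart
  have htop' : topStratumPrime iotaOrdEps (Localization.AtPrime (𝔮.asIdeal.map (algebraMap A (Localization.Away s))))
      (algebraMap (Localization.Away s) _ (algebraMap A (Localization.Away s) F)) =
      (𝔭.map (algebraMap A (Localization.Away s))).map
        (algebraMap (Localization.Away s) (Localization.AtPrime (𝔮.asIdeal.map (algebraMap A (Localization.Away s))))) := by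
    rw [← he F, topStratumPrime_ringEquiv iotaOrdEps e iotaOrdEps_isoInvariant, htop, Ideal.comap_coe, Ideal.comap_symm,
      ← Ideal.map_coe (f := e) (I := 𝔭.map (algebraMap A (Localization.AtPrime 𝔮.asIdeal))), Ideal.map_map, Ideal.map_map]
    congr 1
    exact RingHom.ext fun a => he a
  -- the nine clauses of the chart set
  refine ⟨?_, ?_, IsRegularLocalRing.of_ringEquiv e, isPrime_map_atPrime_of_le _ _ (Ideal.map_mono hlt.le), hu', ?_, ?_, ?_, ?_, htop'⟩
  · -- `P' < Q'`
    refine lt_of_le_of_ne (Ideal.map_mono hlt.le) fun heq => hlt.ne ?_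
    rw [← comap_map_away s 𝔭 hs𝔭, heq, comap_map_away s 𝔮.asIdeal hs𝔮]
  · -- covering
    intro q' hq' hlt' hle'
    haveI := hq'
    exact eq_of_height_of_lt_of_le hhtP' hhtQ' q' hq' hlt' hle'
  · -- independent pair
    convert hli' using 1
    funext i
    congr 1
    exact Subtype.ext (he _).symm
  · -- tie position
    rw [← he F]
    exact (isTiePosition_ringEquiv_iff e _).mpr htie
  · -- `f ∈ 𝔪^n`
    rw [← he F]
    exact (apply_mem_maximalIdeal_pow_iff e _ n).mpr hfn
  · -- `f ∉ 𝔪^(n+1)`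
    rw [← he F]
    exact fun h => hfn1 ((apply_mem_maximalIdeal_pow_iff e _ (n + 1)).mp h)


end TieFinite

end Summit.ResolutionOfSingularities.ResolutionOfSingularities.Cruxes.HypersurfaceCentreConstruction.LocalEngine

end
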